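import Mathlib
import Literature.Probability.Percolation.Percolation
import Literature.Probability.Percolation.DiagonalStripColumns
import Literature.Probability.Percolation.DiagonalColumnPatterns
import Literature.Probability.Percolation.DiagonalStripTransferLaw
import Literature.Probability.Percolation.DiagonalStripTransferExplicit
import Literature.Probability.Percolation.DiagonalStripLumping
import Literature.Probability.LatticeModels.TemperleyLiebBaxterization
import HarnessLib

/-!
# Ikhlef–Ponsaing's inhomogeneous double-row transfer matrix in the cluster language

Topic `Literature/Probability/Percolation`. Ikhlef–Ponsaing (J. Stat. Phys. 149 (2012),
arXiv:1202.5476) Def. 3.3: `t(w; z_1, …, z_L) = Tr_w[R(w,z_1) ⋯ R(w,z_L) R(z_L,1/w) ⋯ R(z_1,1/w)]`,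
two rows of tiles with the `R`-matrix of Def. 3.1,
`R(w,z) = ([qz/w]/[qw/z]) ▦₁ + ([z/w]/[qw/z]) ▦₂`, `[x] = x - 1/x`, reflecting ends. By Baxter's
cluster–loop correspondence (§2.1) a tile is a lattice EDGE of the diagonal strip of
`DiagonalStrip*.lean` (the `2m + 1 = L` edges of a layer; the edge whose upper endpoint has level
`k` carries the vertical rapidity `z_k`), the two tile pictures are "edge open / edge closed", and a
row of tiles is one layer `colUpdate`. This file writes `t(w; z⃗)` in that language:

* `ipTransferW m c p P P'` — the one-layer kernel with an arbitrary edge weight `p : edge → K`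
  ("open with weight `p e`, closed with weight `1 - p e`", independently over the lattice edges of
  the layer); `sum_ipTransferW` (row sums `1`); **`ipTransferW_half`**: at `p ≡ 1/2` it is the
  percolation kernel `ipTransfer` (`ipTransfer_eq_sum'`);
* `ipWtA q x = [qx]/[q/x]`, `ipWtB q x = [x]/[q/x]` — the two tile weights as functions of the
  ratio `x` of rapidities, `ipWtA_add_ipWtB` (`= 1` when `q² + q + 1 = 0`, i.e. `n = 1`);
* `edgeTopLevel`, `ipRowWeight q w z r` — the weights of IP12's two rows: the edge of top level `k`
  is open with weight `A(z_k/w)` (`k` odd) / `B(z_k/w)` (`k` even) in the first row and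
  `A(1/(w z_k))` / `B(1/(w z_k))` in the second (the alternation in `k` is the alternating orientation
  of the primal edge inside the tiles of the medial lattice);
* **`ipTransferMatrixW m q w z Q Q'`** — `t(w; z⃗)` as a kernel on column patterns, lumped at the
  even column (Def. 3.3 in the cluster language) = `ipTwoLayerW` with IP12's row weights
  (`ipTransferMatrixW_eq`, `sum_ipTwoLayerW`), and **`ipTwoLayerW_const_half`**: with all
  weights `1/2` (the percolation point) the two-layer kernel is the lumped kernel
  `∑_{Q₁} T̄₀(Q,Q₁) T̄₁(Q₁,Q')` of `DiagonalStripLumping.lean`, whose unique stationary vector is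
  `ipStationaryL m` — so IP12's ground state at the homogeneous percolation point is `π̄_m`.

These conventions were fixed by checking numerically (m = 1, 2, random complex parameters) the four
properties IP12 uses: `[t(w), t(w')] = 0`, the interlacing relation of Lemma 3.2 with
`Ř_i(z_i/z_{i+1})` for the connectivity-basis generators (`e_{2b+1}` = join, `e_{2b}` = isolate),
the boundary reflections `z_1 → 1/z_1`, `z_L → 1/z_L`, and `t(w;1⃗) Ψ = Ψ` with eigenvalue `1`;
their proofs are NOT in this file.

## References

* Y. Ikhlef, A. K. Ponsaing, J. Stat. Phys. 149 (2012) 10–36, arXiv:1202.5476, §2.1, Defs. 3.1,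
  3.3, Lemma 3.2. [IkhlefPonsaing2012]
-/

namespace Literature.Probability.Percolation

open Finset Literature.Probability.LatticeModels Literature.Probability.LatticeModels.TemperleyLieb

variable {K : Type*} [Field K] {m : ℕ}

/-! ### One layer with arbitrary edge weights -/

/-- **The weighted one-layer kernel**: the lattice edges of the layer `c` are open independently,
the edge `e` with weight `p e` (closed: `1 - p e`); `T^p_c(P, P')` is the total weight of the edge
sets updating `P` to `P'`. [cite: IkhlefPonsaing2012, Def. 3.3] -/
noncomputable def ipTransferW (m : ℕ) (c : ℤ) (p : Sym2 (Site 2) → K) (P P' : ColPattern m) : K :=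
  ∑ U ∈ (latticeLayer m c).powerset,
    if colUpdate m c P (edgeFn m c U) = P' then (∏ e ∈ U, p e) * ∏ e ∈ latticeLayer m c \ U, (1 - p e)
    else 0

/-- **Row sums are `1`** (the two tile weights add up to `1`). [cite: IkhlefPonsaing2012, §3.1] -/
theorem sum_ipTransferW (c : ℤ) (p : Sym2 (Site 2) → K) (P : ColPattern m) :
    ∑ P', ipTransferW m c p P P' = 1 := by
  classical
  unfold ipTransferW
  rw [sum_comm]
  have : ∀ U ∈ (latticeLayer m c).powerset,
      (∑ P' : ColPattern m, if colUpdate m c P (edgeFn m c U) = P' then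
        (∏ e ∈ U, p e) * ∏ e ∈ latticeLayer m c \ U, (1 - p e) else 0) =
        (∏ e ∈ U, p e) * ∏ e ∈ latticeLayer m c \ U, (1 - p e) := fun U _ => by
    rw [sum_ite_eq]; simp
  rw [sum_congr rfl this, ← prod_add]
  simp

/-- **At `p ≡ 1/2` the weighted kernel is the percolation kernel** `T_c` of
`DiagonalStripTransferLaw.lean`. [cite: IkhlefPonsaing2012, §3.1] -/
theorem ipTransferW_half (c : ℤ) (P P' : ColPattern m) :
    ipTransferW m c (fun _ => (1 / 2 : ℝ)) P P' = ipTransfer m c P P' := by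
  classical
  rw [ipTransfer_eq_sum']
  unfold ipTransferW
  refine sum_congr rfl fun U hU => ?_
  split_ifs with h
  · rw [prod_const, prod_const, show (1 - 1 / 2 : ℝ) = 1 / 2 by norm_num, ← pow_add,
      card_sdiff_of_subset (mem_powerset.1 hU), Nat.add_sub_cancel' (card_le_card (mem_powerset.1 hU)),
      card_latticeLayer]
  · rfl

/-! ### IP12's tile weights -/

/-- The weight of the first tile picture as a function of the rapidity ratio: `A(x) = [qx]/[q/x]`
(`R(w,z)`'s first coefficient at `x = z/w`). [cite: IkhlefPonsaing2012, Def. 3.1] -/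
noncomputable def ipWtA (q x : K) : K := qbr (q * x) / qbr (q / x)

/-- The weight of the second tile picture: `B(x) = [x]/[q/x]`. [cite: IkhlefPonsaing2012, Def. 3.1] -/
noncomputable def ipWtB (q x : K) : K := qbr x / qbr (q / x)

/-- **The two tile weights add up to `1`** at loop weight `n = -(q+q⁻¹) = 1` (`q² + q + 1 = 0`):
`[qx] + [x] = [q/x]`. [cite: IkhlefPonsaing2012, §3.1 ("when `n=1` all the weights are probabilities")] -/
theorem ipWtA_add_ipWtB {q x : K} (hq : q ^ 2 + q + 1 = 0) (hqx : qbr (q / x) ≠ 0) :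
    ipWtA q x + ipWtB q x = 1 := by
  have hinv : q⁻¹ = -(q + 1) := inv_eq_of_mul_eq_one_right (by linear_combination -hq)
  have key : qbr (q * x) + qbr x = qbr (q / x) := by
    unfold qbr
    rw [mul_inv, inv_div, div_eq_mul_inv q x, div_eq_mul_inv x q, hinv]
    ring
  unfold ipWtA ipWtB
  rw [← add_div, key, div_self hqx]

/-- The level `x₀ + x₁` of the upper endpoint of an edge (the index `k` of the vertical rapidity
line through the tile). [folklore] -/
def edgeTopLevel : Sym2 (Site 2) → ℤ :=
  Sym2.lift ⟨fun x y => max (x 0 + x 1) (y 0 + y 1), fun _ _ => max_comm _ _⟩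

/-- The top level of an edge, on representatives. [folklore] -/
@[simp] theorem edgeTopLevel_mk (x y : Site 2) : edgeTopLevel s(x, y) = max (x 0 + x 1) (y 0 + y 1) := rfl

/-- **IP12's row weights** (open-edge weights of the two rows of Def. 3.3): in row `r = 0` the edge of
top level `k` is open with weight `A(z_k/w)` for odd `k`, `B(z_k/w)` for even `k`; in row `r = 1`
(rapidity `1/w` on the returning auxiliary line, `R(z_k, 1/w)`) with `A(1/(w z_k))`, `B(1/(w z_k))`.
[cite: IkhlefPonsaing2012, Def. 3.3] -/
noncomputable def ipRowWeight (q w : K) (z : ℕ → K) (r : Fin 2) (e : Sym2 (Site 2)) : K :=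
  if (edgeTopLevel e).toNat % 2 = 1 then
    ipWtA q (if r = 0 then z (edgeTopLevel e).toNat / w else (w * z (edgeTopLevel e).toNat)⁻¹)
  else ipWtB q (if r = 0 then z (edgeTopLevel e).toNat / w else (w * z (edgeTopLevel e).toNat)⁻¹)

/-! ### The double-row transfer matrix -/

/-- **IP12's transfer matrix `t(w; z_1, …, z_L)` in the cluster language** (Def. 3.3, `L = 2m+1`):
first row = layer `0 → 1` with the row-`0` weights, second row = layer `1 → 2` with the row-`1`
weights, result lumped at the even column; an entry `t(Q → Q')` for column patterns `Q, Q'`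
(meaningful for lump-fixed valid planar even patterns, i.e. on `NCState (m+1)` ≅ `LP_L`).
[cite: IkhlefPonsaing2012, Def. 3.3] -/
noncomputable def ipTransferMatrixW (m : ℕ) (q w : K) (z : ℕ → K) (Q Q' : ColPattern m) : K :=
  ∑ P₁ : ColPattern m, ∑ P₂ ∈ univ.filter (fun P₂ : ColPattern m => lump P₂ = Q'),
    ipTransferW m 0 (ipRowWeight q w z 0) Q P₁ * ipTransferW m 1 (ipRowWeight q w z 1) P₁ P₂

/-- The general two-layer lumped kernel with arbitrary weights in the two rows. [folklore] -/
noncomputable def ipTwoLayerW (m : ℕ) (p₀ p₁ : Sym2 (Site 2) → K) (Q Q' : ColPattern m) : K :=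
  ∑ P₁ : ColPattern m, ∑ P₂ ∈ univ.filter (fun P₂ : ColPattern m => lump P₂ = Q'),
    ipTransferW m 0 p₀ Q P₁ * ipTransferW m 1 p₁ P₁ P₂

/-- `t(w; z⃗)` is the two-layer kernel with IP12's row weights. [folklore] -/
theorem ipTransferMatrixW_eq (q w : K) (z : ℕ → K) (Q Q' : ColPattern m) :
    ipTransferMatrixW m q w z Q Q' = ipTwoLayerW m (ipRowWeight q w z 0) (ipRowWeight q w z 1) Q Q' := rfl

/-- **Row sums of `t` are `1`** (for any weights). [cite: IkhlefPonsaing2012, §3.1] -/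
theorem sum_ipTwoLayerW (p₀ p₁ : Sym2 (Site 2) → K) (Q : ColPattern m) :
    ∑ Q', ipTwoLayerW m p₀ p₁ Q Q' = 1 := by
  classical
  unfold ipTwoLayerW
  rw [sum_comm]
  have h1 : ∀ P₁ : ColPattern m,
      (∑ Q', ∑ P₂ ∈ univ.filter (fun P₂ : ColPattern m => lump P₂ = Q'),
        ipTransferW m 0 p₀ Q P₁ * ipTransferW m 1 p₁ P₁ P₂) =
        ipTransferW m 0 p₀ Q P₁ := by
    intro P₁
    rw [sum_fiberwise univ lump fun P₂ => ipTransferW m 0 p₀ Q P₁ * ipTransferW m 1 p₁ P₁ P₂,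
      ← mul_sum, sum_ipTransferW, mul_one]
  simp_rw [h1]
  exact sum_ipTransferW 0 p₀ Q

/-- **At the percolation point `t` is the lumped two-layer kernel of the dictionary**: with all
weights `1/2`, `t(Q → Q') = ∑_{Q₁} T̄₀(Q,Q₁) T̄₁(Q₁,Q')` (`ipTransferL` of `DiagonalStripLumping.lean`),
whose unique stationary probability vector is `ipStationaryL m` (`eq_ipStationaryL_of_fixed`).
[cite: IkhlefPonsaing2012, §3.1, §3.4] -/
theorem ipTwoLayerW_const_half (Q Q' : ColPattern m) :
    ipTwoLayerW m (fun _ => (1 / 2 : ℝ)) (fun _ => (1 / 2 : ℝ)) Q Q' =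
      ∑ Q₁ ∈ univ.filter (fun Q₁ : ColPattern m => lump Q₁ = Q₁),
        ipTransferL m 0 Q Q₁ * ipTransferL m 1 Q₁ Q' := by
  classical
  unfold ipTwoLayerW
  simp only [ipTransferW_half]
  -- group the intermediate patterns `P₁` by their lumping
  have hfib : (∑ P₁ : ColPattern m, ∑ P₂ ∈ univ.filter (fun P₂ : ColPattern m => lump P₂ = Q'),
      ipTransfer m 0 Q P₁ * ipTransfer m 1 P₁ P₂) =
      ∑ Q₁ ∈ univ.filter (fun Q₁ : ColPattern m => lump Q₁ = Q₁),
        ∑ P₁ ∈ univ.filter (fun P₁ : ColPattern m => lump P₁ = Q₁),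
          ∑ P₂ ∈ univ.filter (fun P₂ : ColPattern m => lump P₂ = Q'),
            ipTransfer m 0 Q P₁ * ipTransfer m 1 P₁ P₂ := by
    symm
    exact sum_fiberwise_of_maps_to (fun P₁ _ => mem_filter.2 ⟨mem_univ _, lump_lump P₁⟩) _
  rw [hfib]
  refine sum_congr rfl fun Q₁ _ => ?_
  simp only [ipTransferL, lumpLaw]
  rw [sum_mul]
  refine sum_congr rfl fun P₁ hP₁ => ?_
  have hPQ : lump P₁ = Q₁ := (mem_filter.1 hP₁).2
  -- the lumped row of `P₁` equals that of `lump P₁ = Q₁`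
  have key : (∑ P₂ ∈ univ.filter (fun P₂ : ColPattern m => lump P₂ = Q'), ipTransfer m 1 P₁ P₂) =
      ∑ P₂ ∈ univ.filter (fun P₂ : ColPattern m => lump P₂ = Q'), ipTransfer m 1 Q₁ P₂ := by
    have := congrFun (lumpLaw_ipTransfer_lump 1 P₁) Q'
    simp only [lumpLaw] at this
    rw [← this, hPQ]
  rw [← mul_sum, key]

end Literature.Probability.Percolation
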